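import Summits.Ventures.PercRepro.Partition
import Summits.Ventures.PercRepro.DecisionTreeCSLower

/-!
# The exploration tree of a cluster, and what it decides

`MultiGraph.explore G U K` is the decision tree that, as long as some unqueried edge (in `U`)
touches the known set `K`, queries such an edge, sends it to `S`, and — if it is open in the
first configuration — adds its endpoints to `K`; it stops when no unqueried edge touches `K`
(Gladkov–Zimin's tree exploring the component of a vertex, arXiv:2404.08873 Example 4.4 /
arXiv:2408.08457 Algorithm 1).  `exploreTree G a = explore G univ {a}`.

* `allS_explore`: every node sends its edge to `S`;
* `proper_explore`: the tree is proper with respect to any queried set disjoint from `U`;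
* `decides_explore` / `decides_exploreTree`: at every leaf the revealed states decide every
  event determined by the cluster of `a` — e.g. `{a ≁ b} ∪ {a ≁ c}` — because on the leaf's
  cylinder the cluster of `a` is exactly the known set `K` (`cluster_eq_of_leaf`).
-/

namespace PercRepro

namespace MultiGraph

open Finset

variable {V E : Type*} [DecidableEq V] (G : MultiGraph V E)

/-- The unqueried edges of `U` touching the vertex set `K`. -/
def frontier (U : Finset E) (K : Finset V) : Finset E :=
  U.filter fun e => G.fst e ∈ K ∨ G.snd e ∈ K

/-- The endpoints of an edge added to a vertex set. -/
def addEnds (K : Finset V) (e : E) : Finset V := insert (G.fst e) (insert (G.snd e) K)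

variable [DecidableEq E]

/-- **The exploration tree**: query an unqueried edge touching `K`, send it to `S`, and grow `K`
by its endpoints if it is open in the first configuration; stop when no unqueried edge touches
`K`. -/
noncomputable def explore : Finset E → Finset V → DTree E
  | U, K =>
    if h : (G.frontier U K).Nonempty then
      DTree.node h.choose true fun b _ =>
        explore (U.erase h.choose) (if b then G.addEnds K h.choose else K)
    else DTree.leaf
termination_by U _ => U.card
decreasing_by
  all_goals
    exact Finset.card_erase_lt_of_mem (Finset.mem_of_mem_filter _ h.choose_spec)

/-- The exploration tree of the cluster of `a`. -/
noncomputable def exploreTree [Fintype E] (a : V) : DTree E := G.explore Finset.univ {a}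

variable {G}

omit [DecidableEq E] in
/-- An edge of the frontier is an unqueried edge touching `K`. -/
theorem mem_frontier {U : Finset E} {K : Finset V} {e : E} :
    e ∈ G.frontier U K ↔ e ∈ U ∧ (G.fst e ∈ K ∨ G.snd e ∈ K) := by
  simp [frontier]

/-- Every node of the exploration tree sends its edge to `S`. -/
theorem allS_explore : ∀ (U : Finset E) (K : Finset V), DTree.AllS (G.explore U K) := by
  intro U
  induction U using Finset.strongInduction with
  | H U ih =>
    intro K
    rw [explore]
    split_ifs with h
    · exact ⟨rfl, fun b _ =>
        ih _ (Finset.erase_ssubset (mem_frontier.mp h.choose_spec).1) _⟩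
    · trivial

/-- The exploration tree is proper with respect to every queried set disjoint from `U`. -/
theorem proper_explore : ∀ (U : Finset E) (K : Finset V) (Q : Set E), (∀ e ∈ U, e ∉ Q) →
    DTree.Proper (G.explore U K) Q := by
  intro U
  induction U using Finset.strongInduction with
  | H U ih =>
    intro K Q hQ
    rw [explore]
    split_ifs with h
    · have he : h.choose ∈ U := (mem_frontier.mp h.choose_spec).1
      refine ⟨hQ _ he, fun b b' => ih _ (Finset.erase_ssubset he) _ _ ?_⟩
      intro e' he' hmem
      rcases Set.mem_insert_iff.mp hmem with h' | hmem'
      · rw [h'] at he'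
        exact Finset.notMem_erase _ U he'
      · exact hQ e' (Finset.mem_of_mem_erase he') hmem'
    · trivial

/-- **What the exploration tree decides.**  Along the exploration, the known set `K` is
contained in the cluster of `a` of every configuration consistent with the revealed states,
every revealed open edge has both endpoints in `K`, and the unqueried edges are exactly the
edges outside the queried set; at a leaf no unqueried edge touches `K`, so the cluster of `a`
is exactly `K` on the leaf's cylinder, and every event determined by the cluster of `a` is
decided. -/
theorem decides_explore (a : V) {A : Set (Config E)}
    (hA : ∀ ω ζ : Config E, G.cluster ω a = G.cluster ζ a → (ω ∈ A ↔ ζ ∈ A)) :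
    ∀ (U : Finset E) (K : Finset V) (Q : Set E) (v : E → Bool),
      (∀ e, e ∈ U ↔ e ∉ Q) → a ∈ K →
      (∀ ω : Config E, (∀ e ∈ Q, ω e = v e) → ∀ x ∈ K, G.Conn ω a x) →
      (∀ e ∈ Q, v e = true → G.fst e ∈ K ∧ G.snd e ∈ K) →
      DTree.Decides (G.explore U K) Q v A := by
  intro U
  induction U using Finset.strongInduction with
  | H U ih =>
    intro K Q v hUQ haK hK hopen
    rw [explore]
    split_ifs with h
    · -- a node: query `e`, continue with the invariants
      set e := h.choose with he_def
      have he : e ∈ U ∧ (G.fst e ∈ K ∨ G.snd e ∈ K) := mem_frontier.mp h.choose_spec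
      have heQ : e ∉ Q := (hUQ e).mp he.1
      intro b b'
      refine ih _ (Finset.erase_ssubset he.1) _ _ _ ?_ ?_ ?_ ?_
      · intro e'
        rw [Finset.mem_erase, hUQ e', Set.mem_insert_iff]
        tauto
      · split_ifs
        · exact Finset.mem_insert_of_mem (Finset.mem_insert_of_mem haK)
        · exact haK
      · intro ω hω x hx
        have hωQ : ∀ e' ∈ Q, ω e' = v e' := by
          intro e' he'
          have hne : e' ≠ e := fun h' => heQ (h' ▸ he')
          have := hω e' (Set.mem_insert_of_mem _ he')
          rwa [Function.update_of_ne hne] at this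
        have hωe : ω e = b := by
          have := hω e (Set.mem_insert e Q)
          rwa [Function.update_self] at this
        split_ifs at hx with hb
        · -- `e` is open: its endpoints join the cluster
          subst hb
          have hconn : G.Conn ω a (G.fst e) ∧ G.Conn ω a (G.snd e) := by
            rcases he.2 with hf | hs
            · exact ⟨hK ω hωQ _ hf, (hK ω hωQ _ hf).tail (G.openAdj_of_open e hωe)⟩
            · exact ⟨(hK ω hωQ _ hs).tail (G.openAdj_of_open e hωe).symm, hK ω hωQ _ hs⟩
          simp only [addEnds, Finset.mem_insert] at hx
          rcases hx with rfl | rfl | hx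
          · exact hconn.1
          · exact hconn.2
          · exact hK ω hωQ x hx
        · exact hK ω hωQ x hx
      · intro e' he' hv
        rcases Set.mem_insert_iff.mp he' with rfl | he'Q
        · rw [Function.update_self] at hv
          subst hv
          simp [addEnds]
        · have hne : e' ≠ e := fun h' => heQ (h' ▸ he'Q)
          rw [Function.update_of_ne hne] at hv
          have := hopen e' he'Q hv
          split_ifs
          · exact ⟨Finset.mem_insert_of_mem (Finset.mem_insert_of_mem this.1),
              Finset.mem_insert_of_mem (Finset.mem_insert_of_mem this.2)⟩
          · exact this
    · -- a leaf: the cluster of `a` is `K` on the cylinder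
      have hcl : ∀ ω : Config E, (∀ e ∈ Q, ω e = v e) → G.cluster ω a = ↑K := by
        intro ω hω
        ext x
        constructor
        · intro hx
          refine mem_of_conn_of_closed_boundary (ω := ω) (X := (↑K : Set V)) ?_
            (Finset.mem_coe.mpr haK) hx
          intro e' he'
          by_cases htouch : G.fst e' ∈ K ∨ G.snd e' ∈ K
          · have he'Q : e' ∈ Q := by
              by_contra hq
              exact h ⟨e', mem_frontier.mpr ⟨(hUQ e').mpr hq, htouch⟩⟩
            have hv : v e' = true := (hω e' he'Q).symm.trans he'
            have := hopen e' he'Q hv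
            simp [this.1, this.2]
          · simp only [not_or] at htouch
            simp [htouch.1, htouch.2]
        · intro hx
          exact hK ω hω x (Finset.mem_coe.mp hx)
      intro ω ζ hω hζ
      exact hA ω ζ ((hcl ω hω).trans (hcl ζ hζ).symm)

/-! ### The exploration tree of `a` and Gladkov's Corollary 5.3 -/

section Corollary

variable [Fintype E]

omit [DecidableEq V] [DecidableEq E] [Fintype E] in
/-- Membership in `{a ≁ b} ∪ {a ≁ c}` depends only on the cluster of `a`. -/
theorem mem_sep_union_of_cluster_eq (a b c : V) (ω ζ : Config E)
    (h : G.cluster ω a = G.cluster ζ a) :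
    ω ∈ G.sepEvent a b ∪ G.sepEvent a c ↔ ζ ∈ G.sepEvent a b ∪ G.sepEvent a c := by
  have hb : G.Conn ω a b ↔ G.Conn ζ a b := by
    change b ∈ G.cluster ω a ↔ b ∈ G.cluster ζ a
    rw [h]
  have hc : G.Conn ω a c ↔ G.Conn ζ a c := by
    change c ∈ G.cluster ω a ↔ c ∈ G.cluster ζ a
    rw [h]
  simp only [Set.mem_union, mem_sepEvent, hb, hc]

/-- The exploration tree of `a` sends every edge to `S`. -/
theorem allS_exploreTree (a : V) : DTree.AllS (G.exploreTree a) := allS_explore _ _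

/-- The exploration tree of `a` is proper. -/
theorem proper_exploreTree (a : V) : DTree.Proper (G.exploreTree a) ∅ :=
  proper_explore _ _ _ fun _ _ h => h

/-- The exploration tree of `a` decides every event determined by the cluster of `a`. -/
theorem decides_exploreTree (a : V) {A : Set (Config E)}
    (hA : ∀ ω ζ : Config E, G.cluster ω a = G.cluster ζ a → (ω ∈ A ↔ ζ ∈ A)) :
    DTree.Decides (G.exploreTree a) ∅ (fun _ => false) A :=
  decides_explore a hA _ _ _ _ (fun e => by simp) (Finset.mem_singleton_self a)
    (fun ω _ x hx => by rw [Finset.mem_singleton.mp hx]; exact Conn.refl G ω a)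
    (fun e he => absurd he (Set.notMem_empty e))

/-- **Gladkov's Corollary 5.3, eq. (11)**: for every proper continuation `t₂` of the exploration
tree of `a` (a tree that first reveals the cluster of `a` and sends its edges to `S`),
`P(a|b|c)² ≤ P(a|b ∪ a|c) · P(ω ∈ a|b|c ∧ ω →_{run t₂ ω ω'} ω' ∈ a|b|c)`. -/
theorem cor53_iso {p : E → ℝ} (hp : IsProb p) (a b c : V) {t₂ : DTree E}
    (hc : DTree.Continues (G.exploreTree a) t₂) (ht₂ : DTree.Proper t₂ ∅) :
    prob p (G.sepEvent a b ∩ G.sepEvent a c ∩ G.sepEvent b c) ^ 2 ≤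
      prob p (G.sepEvent a b ∪ G.sepEvent a c) *
        ∑ ω, ∑ ω', weight p ω * weight p ω' *
          ((G.sepEvent a b ∩ G.sepEvent a c ∩ G.sepEvent b c).indicator 1 ω *
            (G.sepEvent a b ∩ G.sepEvent a c ∩ G.sepEvent b c).indicator 1
              (mix (DTree.run t₂ ω ω') ω ω')) := by
  have hM : IsLowerSet (G.sepEvent a b ∩ G.sepEvent a c ∩ G.sepEvent b c) :=
    ((G.isLowerSet_sepEvent a b).inter (G.isLowerSet_sepEvent a c)).inter
      (G.isLowerSet_sepEvent b c)
  have h := DTree.cauchy_schwarz_lower hp (allS_exploreTree (G := G) a) hc ht₂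
    (decides_exploreTree a (mem_sep_union_of_cluster_eq (G := G) a b c)) hM
  have hAM : (G.sepEvent a b ∪ G.sepEvent a c) ∩
      (G.sepEvent a b ∩ G.sepEvent a c ∩ G.sepEvent b c) =
      G.sepEvent a b ∩ G.sepEvent a c ∩ G.sepEvent b c :=
    Set.inter_eq_right.mpr fun ω hω => Or.inl hω.1.1
  rwa [hAM] at h

/-- **Gladkov's Corollary 5.3, eq. (12)**: for every proper continuation `t₂` of the exploration
tree of `a`, `P(a|bc)² ≤ P(a|b ∪ a|c) · P(ω ∈ a|bc ∧ ω →_{run t₂ ω ω'} ω' ∈ a|bc)`. -/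
theorem cor53_bc {p : E → ℝ} (hp : IsProb p) (a b c : V) {t₂ : DTree E}
    (hc : DTree.Continues (G.exploreTree a) t₂) (ht₂ : DTree.Proper t₂ ∅) :
    prob p (G.connEvent b c ∩ G.sepEvent a b) ^ 2 ≤
      prob p (G.sepEvent a b ∪ G.sepEvent a c) *
        ∑ ω, ∑ ω', weight p ω * weight p ω' *
          ((G.connEvent b c ∩ G.sepEvent a b).indicator 1 ω *
            (G.connEvent b c ∩ G.sepEvent a b).indicator 1 (mix (DTree.run t₂ ω ω') ω ω')) := by
  have h := DTree.cauchy_schwarz hp (allS_exploreTree (G := G) a) hc ht₂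
    (decides_exploreTree a (mem_sep_union_of_cluster_eq (G := G) a b c)) (G.isUpperSet_connEvent b c)
  have hAM : (G.sepEvent a b ∪ G.sepEvent a c) ∩ G.connEvent b c =
      G.connEvent b c ∩ G.sepEvent a b := by
    ext ω
    obtain ⟨h1, h2, h3⟩ := G.conn_three_trans a b c (ω := ω)
    simp only [Set.mem_inter_iff, Set.mem_union, mem_sepEvent, mem_connEvent]
    tauto
  rwa [hAM] at h

end Corollary

end MultiGraph

end PercRepro
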